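import Literature.Geometry.DiscreteGeometry.KissingMainEstimate
import Literature.Geometry.DiscreteGeometry.SphericalCodeHullEulerFormula
import Literature.Geometry.DiscreteGeometry.KissingSaturationKissingNumber
import HarnessLib

/-!
# The facets of the Delaunay polyhedron of a kissing configuration, on the unit sphere
# (Hales 2012, proof of Theorem 2: "circumradius less than `√3`", "edges … `< 2√3`",
# "the upper bound on the long edge is `√(32/3)`"; Lemma 5: `Σ τ = 4π − 20 sol₀`) — proved

Topic `Literature/Geometry/DiscreteGeometry`; provefact brick for `Hales2012_contactGraphTame`
(`TameContactGraphs.lean`), preparing the application of the per-triangle main estimate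
(`KissingMainEstimate.lean`) to the FACETS of the Delaunay polyhedron `conv V` of `V ∈ 𝒱`
(`facetNormals`, `tightSet` of `ConvexHullFacets.lean`; Legendre's identity of
`SphericalCodeHullEuler.lean`).  Normalisation: the unit sphere, `X = V/2` — twelve unit
vectors with pairwise inner products `≤ 1/2`.

* Part A, the dictionary `S²(2) → S²` for twelve unit vectors with pairwise inner products
  `≤ 1/2`: every direction is within `60°` of a point (`exists_half_lt_inner_of_twelve`, the
  kissing number `k(3) = 12` through `exists_dist_lt_two_of_twelve`); hence **facet normals
  have norm `< 2`** (`norm_lt_two_of_mem_facetNormals`: the facet circle has angular radius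
  `< 60°` — Hales's "Euclidean triangular circumradius less than `√3`" on `S²(2)`), the
  vertices of a facet lie on a cap `⟪axis, ·⟫ = t > 1/2` (`half_lt_inner_facetAxis`), two of
  them have inner product `> −1/2` (`neg_half_lt_inner_of_tight` — edges `< 2√3`), three have
  side cosines summing to `> −3/8` (`sum_inner_gt_of_tight`), and **an isosceles contact
  triangle in a facet has base cosine `> −1/3`** (`neg_third_lt_inner_of_isosceles_tight` —
  "the circumradius-derived upper bound on the long edge is `√(32/3)`", the input of the sharp
  case `(2,0,1)` of the main estimate): the planar circumradius identity `L² = 4 − ρ⁻²` from the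
  vanishing Gram determinant of three vectors of the facet plane.
* Part B, **Lemma 5 in facet form** (`sum_facet_weight_eq`): with `m_c` the number of vertices
  of the facet of `c` and `frac(c)` the fraction of the unit ball in the cone over it,
  `Σ_c (4π · frac(c) − (m_c − 2) sol₀) = 4π − 20 sol₀` (`Σ frac = 1`, `Σ m_c = 24 + 2F − 4`).

Everything is PROVED; no named facts.  The estimate itself (per fan triangle of a facet, and
summed) is `KissingFacetPenalty.lean`.

## References
* T. C. Hales, arXiv:1209.6043 (2012): proof of Theorem 2 (p. 6–7), §4 (`τ`), Lemma 5
  [UCEUZYO]. [`Hales2012`]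
-/

noncomputable section

namespace Literature.Geometry.DiscreteGeometry

open Real RealInnerProductSpace InnerProductGeometry Finset
open scoped Pointwise

section UnitDictionary

local notation "E3" => EuclideanSpace ℝ (Fin 3)

variable {X : Finset E3}

/-! ### Part A. Twelve unit vectors: covering, facet normals, vertices of a facet -/

/-- For unit vectors, `‖y − y'‖² = 2 − 2⟪y, y'⟫`. [folklore] -/
theorem norm_sub_sq_of_unit {y y' : E3} (hy : ‖y‖ = 1) (hy' : ‖y'‖ = 1) :
    ‖y - y'‖ ^ 2 = 2 - 2 * ⟪y, y'⟫ := by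
  rw [norm_sub_sq_real, hy, hy']; ring

/-- **The doubled configuration `2X ⊂ S²(2)`** of twelve unit vectors with pairwise inner
products `≤ 1/2` is a twelve-point packing on `S²(2)` (pairwise distances `≥ 2`), the setting of
`KissingSaturationKissingNumber.lean`. [folklore] -/
theorem two_smul_image_props (h12 : X.card = 12) (hX1 : ∀ y ∈ X, ‖y‖ = 1)
    (hp : ∀ y ∈ X, ∀ y' ∈ X, y ≠ y' → ⟪y, y'⟫ ≤ 1 / 2) :
    ((fun y => (2 : ℝ) • y) '' (X : Set E3)).ncard = 12 ∧
      (∀ s ∈ (fun y => (2 : ℝ) • y) '' (X : Set E3), ‖s‖ = 2) ∧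
      (∀ s ∈ (fun y => (2 : ℝ) • y) '' (X : Set E3), ∀ t ∈ (fun y => (2 : ℝ) • y) '' (X : Set E3),
        s ≠ t → 2 ≤ dist s t) := by
  have hinj : Function.Injective fun y : E3 => (2 : ℝ) • y := smul_right_injective E3 two_ne_zero
  refine ⟨?_, ?_, ?_⟩
  · rw [Set.ncard_image_of_injective _ hinj, Set.ncard_coe_finset, h12]
  · rintro _ ⟨y, hy, rfl⟩
    rw [norm_smul, Real.norm_two, hX1 y hy, mul_one]
  · rintro _ ⟨y, hy, rfl⟩ _ ⟨y', hy', rfl⟩ hne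
    have hne' : y ≠ y' := fun h => hne (by rw [h])
    have h := hp y hy y' hy' hne'
    have hd : dist ((2 : ℝ) • y) ((2 : ℝ) • y') ^ 2 = 4 * (2 - 2 * ⟪y, y'⟫) := by
      rw [dist_eq_norm, ← smul_sub, norm_smul, Real.norm_two, mul_pow, norm_sub_sq_of_unit
        (hX1 y hy) (hX1 y' hy')]
      ring
    nlinarith [dist_nonneg (x := (2 : ℝ) • y) (y := (2 : ℝ) • y')]

/-- **Twelve unit vectors with pairwise inner products `≤ 1/2` see every direction within
`60°`**: for every unit `n` some `y ∈ X` has `⟪n, y⟫ > 1/2` — the kissing number `k(3) = 12`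
(`exists_dist_lt_two_of_twelve` on `2X ⊂ S²(2)`). [cite: Hales2012, proof of Theorem 2
("`V′` … is a saturated spherical network")] -/
theorem exists_half_lt_inner_of_twelve (h12 : X.card = 12) (hX1 : ∀ y ∈ X, ‖y‖ = 1)
    (hp : ∀ y ∈ X, ∀ y' ∈ X, y ≠ y' → ⟪y, y'⟫ ≤ 1 / 2) {n : E3} (hn : ‖n‖ = 1) :
    ∃ y ∈ X, 1 / 2 < ⟪n, y⟫ := by
  obtain ⟨hS12, hSn, hSp⟩ := two_smul_image_props h12 hX1 hp
  have hx : ‖(2 : ℝ) • n‖ = 2 := by rw [norm_smul, Real.norm_two, hn, mul_one]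
  obtain ⟨_, ⟨y, hy, rfl⟩, hlt⟩ := exists_dist_lt_two_of_twelve hS12 hSn hSp hx
  refine ⟨y, hy, ?_⟩
  have hd : dist ((2 : ℝ) • n) ((2 : ℝ) • y) ^ 2 = 4 * (2 - 2 * ⟪n, y⟫) := by
    rw [dist_eq_norm, ← smul_sub, norm_smul, Real.norm_two, mul_pow,
      norm_sub_sq_of_unit hn (hX1 y hy)]
    ring
  nlinarith [dist_nonneg (x := (2 : ℝ) • n) (y := (2 : ℝ) • y)]

/-- **The origin is an interior point of the hull** of twelve unit vectors with pairwise inner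
products `≤ 1/2` (`zero_mem_interior_convexHull_of_twelve` on `2X`, scaled back).
[cite: Hales2012, proof of Theorem 2] -/
theorem zero_mem_interior_convexHull_of_twelve_unit (h12 : X.card = 12)
    (hX1 : ∀ y ∈ X, ‖y‖ = 1) (hp : ∀ y ∈ X, ∀ y' ∈ X, y ≠ y' → ⟪y, y'⟫ ≤ 1 / 2) :
    (0 : E3) ∈ interior (convexHull ℝ (X : Set E3)) := by
  obtain ⟨hS12, hSn, hSp⟩ := two_smul_image_props h12 hX1 hp
  have h := zero_mem_interior_convexHull_of_twelve hS12 hSn hSp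
  rw [Set.image_smul, convexHull_smul, interior_smul₀ two_ne_zero,
    show (0 : E3) = (2 : ℝ) • (0 : E3) by simp, Set.smul_mem_smul_set_iff₀ two_ne_zero] at h
  exact h

/-- **Facet normals of the hull of twelve such unit vectors have norm `< 2`**: the facet plane
`⟪c, ·⟫ = 1` cuts the sphere in a circle of angular radius `arccos ‖c‖⁻¹ < 60°` (Hales: the
Delaunay triangles have "Euclidean triangular circumradius less than `√3`" on `S²(2)`).
[cite: Hales2012, proof of Theorem 2] -/
theorem norm_lt_two_of_mem_facetNormals (h12 : X.card = 12) (hX1 : ∀ y ∈ X, ‖y‖ = 1)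
    (hp : ∀ y ∈ X, ∀ y' ∈ X, y ≠ y' → ⟪y, y'⟫ ≤ 1 / 2) {c : E3} (hc : c ∈ facetNormals X) :
    ‖c‖ < 2 := by
  have hc0 := ne_zero_of_mem_facetNormals hX1 hc
  have hcpos : 0 < ‖c‖ := norm_pos_iff.2 hc0
  obtain ⟨y, hy, hlt⟩ := exists_half_lt_inner_of_twelve h12 hX1 hp (norm_facetAxis hc0)
  have hle : ⟪c, y⟫ ≤ 1 := (mem_facetNormals.1 hc).1 y hy
  rw [facetAxis, real_inner_smul_left] at hlt
  have h1 : (1 : ℝ) / 2 < ‖c‖⁻¹ :=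
    lt_of_lt_of_le hlt (by simpa using mul_le_mul_of_nonneg_left hle (inv_nonneg.2 hcpos.le))
  rw [lt_inv_comm₀ (by norm_num) hcpos] at h1
  linarith

/-- The vertices of a facet lie on a cap of angular radius `< 60°` about the facet axis:
`⟪c/‖c‖, y⟫ = ‖c‖⁻¹ > 1/2`. [cite: Hales2012, proof of Theorem 2] -/
theorem half_lt_inner_facetAxis (h12 : X.card = 12) (hX1 : ∀ y ∈ X, ‖y‖ = 1)
    (hp : ∀ y ∈ X, ∀ y' ∈ X, y ≠ y' → ⟪y, y'⟫ ≤ 1 / 2) {c : E3} (hc : c ∈ facetNormals X)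
    {y : E3} (hy : y ∈ tightSet X c) : 1 / 2 < ⟪facetAxis c, y⟫ := by
  rw [inner_facetAxis_of_tight (mem_tightSet.1 hy).2]
  have h2 := norm_lt_two_of_mem_facetNormals h12 hX1 hp hc
  have hcpos : 0 < ‖c‖ := norm_pos_iff.2 (ne_zero_of_mem_facetNormals hX1 hc)
  rw [lt_inv_comm₀ (by norm_num) hcpos]
  linarith

/-- The vertices of a facet lie at level `< 1` about the facet axis (`‖c‖ > 1`). [folklore] -/
theorem inner_facetAxis_lt_one (hX1 : ∀ y ∈ X, ‖y‖ = 1) {c : E3} (hc : c ∈ facetNormals X)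
    {y : E3} (hy : y ∈ tightSet X c) : ⟪facetAxis c, y⟫ < 1 := by
  rw [inner_facetAxis_of_tight (mem_tightSet.1 hy).2]
  exact inv_lt_one_of_one_lt₀ (one_lt_norm_of_mem_facetNormals hX1 hc)

/-- Centring on the facet: for a unit `z` on the cap `⟪a, z⟫ = t` of the unit vector `a`,
`‖z − t a‖² = 1 − t²` and `z − t a ⊥ a`. [folklore] -/
theorem norm_sub_smul_sq_of_cap {a z : E3} (ha : ‖a‖ = 1) (hz : ‖z‖ = 1) {t : ℝ}
    (hza : ⟪a, z⟫ = t) : ⟪z - t • a, z - t • a⟫ = 1 - t ^ 2 ∧ ⟪a, z - t • a⟫ = 0 := by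
  have haa : ⟪a, a⟫ = 1 := by rw [real_inner_self_eq_norm_sq, ha, one_pow]
  have hzz : ⟪z, z⟫ = 1 := by rw [real_inner_self_eq_norm_sq, hz, one_pow]
  constructor
  · rw [inner_sub_left, inner_sub_right, inner_sub_right, real_inner_smul_left,
      real_inner_smul_right, real_inner_smul_left, real_inner_smul_right, hzz, haa,
      real_inner_comm a z, hza]
    ring
  · rw [inner_sub_right, real_inner_smul_right, haa, hza]; ring

/-- Centring on the facet: inner products of the centred vectors. [folklore] -/
theorem inner_sub_smul_of_cap {a z z' : E3} (ha : ‖a‖ = 1) {t : ℝ} (hza : ⟪a, z⟫ = t)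
    (hz'a : ⟪a, z'⟫ = t) : ⟪z - t • a, z' - t • a⟫ = ⟪z, z'⟫ - t ^ 2 := by
  have haa : ⟪a, a⟫ = 1 := by rw [real_inner_self_eq_norm_sq, ha, one_pow]
  rw [inner_sub_left, inner_sub_right, inner_sub_right, real_inner_smul_left,
    real_inner_smul_right, real_inner_smul_left, real_inner_smul_right, haa,
    real_inner_comm a z, hza, hz'a]
  ring

/-- **Two vertices of a facet have inner product `> −1/2`** (distance `< √3`; Hales: edges of
Delaunay triangles are `< 2√3` on `S²(2)`): `⟪y, y'⟫ ≥ 2t² − 1` for two points of the cap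
`⟪a, ·⟫ = t`, by Cauchy–Schwarz for the centred vectors. [cite: Hales2012, proof of Theorem 2] -/
theorem neg_half_lt_inner_of_tight (h12 : X.card = 12) (hX1 : ∀ y ∈ X, ‖y‖ = 1)
    (hp : ∀ y ∈ X, ∀ y' ∈ X, y ≠ y' → ⟪y, y'⟫ ≤ 1 / 2) {c : E3} (hc : c ∈ facetNormals X)
    {y y' : E3} (hy : y ∈ tightSet X c) (hy' : y' ∈ tightSet X c) : -1 / 2 < ⟪y, y'⟫ := by
  set a := facetAxis c with ha
  set t := ‖c‖⁻¹ with ht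
  have ha1 : ‖a‖ = 1 := norm_facetAxis (ne_zero_of_mem_facetNormals hX1 hc)
  have hya : ⟪a, y⟫ = t := inner_facetAxis_of_tight (mem_tightSet.1 hy).2
  have hy'a : ⟪a, y'⟫ = t := inner_facetAxis_of_tight (mem_tightSet.1 hy').2
  have hthalf : 1 / 2 < t := hya ▸ half_lt_inner_facetAxis h12 hX1 hp hc hy
  have hy1 := hX1 y (mem_tightSet.1 hy).1
  have hy'1 := hX1 y' (mem_tightSet.1 hy').1
  have h1 := (norm_sub_smul_sq_of_cap ha1 hy1 hya).1
  have h2 := (norm_sub_smul_sq_of_cap ha1 hy'1 hy'a).1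
  have hcs := real_inner_mul_inner_self_le (y - t • a) (y' - t • a)
  rw [inner_sub_smul_of_cap ha1 hya hy'a, h1, h2] at hcs
  -- `(⟪y,y'⟫ − t²)² ≤ (1 − t²)²` and `t > 1/2`; also `⟪y, y'⟫ ≤ 1`
  have hle1 : ⟪y, y'⟫ ≤ 1 := by
    have := real_inner_le_norm y y'; rw [hy1, hy'1, mul_one] at this; exact this
  nlinarith

/-- **Three vertices of a facet have side cosines summing to `> −3/8`.** [folklore] -/
theorem sum_inner_gt_of_tight (h12 : X.card = 12) (hX1 : ∀ y ∈ X, ‖y‖ = 1)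
    (hp : ∀ y ∈ X, ∀ y' ∈ X, y ≠ y' → ⟪y, y'⟫ ≤ 1 / 2) {c : E3} (hc : c ∈ facetNormals X)
    {y₁ y₂ y₃ : E3} (h₁ : y₁ ∈ tightSet X c) (h₂ : y₂ ∈ tightSet X c) (h₃ : y₃ ∈ tightSet X c) :
    -3 / 8 < ⟪y₂, y₃⟫ + ⟪y₁, y₃⟫ + ⟪y₁, y₂⟫ := by
  have hc0 := ne_zero_of_mem_facetNormals hX1 hc
  have h := sum_inner_ge_of_common_cap (norm_facetAxis hc0) (hX1 y₁ (mem_tightSet.1 h₁).1)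
    (hX1 y₂ (mem_tightSet.1 h₂).1) (hX1 y₃ (mem_tightSet.1 h₃).1)
    (inner_facetAxis_of_tight (mem_tightSet.1 h₁).2)
    (inner_facetAxis_of_tight (mem_tightSet.1 h₂).2)
    (inner_facetAxis_of_tight (mem_tightSet.1 h₃).2)
  have ht := half_lt_inner_facetAxis h12 hX1 hp hc h₁
  rw [inner_facetAxis_of_tight (mem_tightSet.1 h₁).2] at ht
  nlinarith

/-- **An isosceles contact triangle in a facet has base cosine `> −1/3`** ("if
`(r,s,t) = (2,0,1)`, then the circumradius-derived upper bound on the long edge is `√(32/3)`":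
squared length `< 32/3` on `S²(2)`, i.e. `< 8/3` on the unit sphere).  For three vertices
`a, b, x` of the facet of `c` with `⟪a, b⟫ = ⟪a, x⟫ = 1/2`: centring at `t · axis` gives three
vectors of the facet plane, whose Gram determinant vanishes; this is
`(1 − t²) ⟪b, x⟫ = t² − 1/2`, and `t > 1/2`. [cite: Hales2012, proof of Theorem 2 (case
(2,0,1))] -/
theorem neg_third_lt_inner_of_isosceles_tight (h12 : X.card = 12) (hX1 : ∀ y ∈ X, ‖y‖ = 1)
    (hp : ∀ y ∈ X, ∀ y' ∈ X, y ≠ y' → ⟪y, y'⟫ ≤ 1 / 2) {c : E3} (hc : c ∈ facetNormals X)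
    {a b x : E3} (ha : a ∈ tightSet X c) (hb : b ∈ tightSet X c) (hx : x ∈ tightSet X c)
    (hab : ⟪a, b⟫ = 1 / 2) (hax : ⟪a, x⟫ = 1 / 2) (hbx : b ≠ x) : -1 / 3 < ⟪b, x⟫ := by
  set n := facetAxis c with hn
  set t := ‖c‖⁻¹ with ht
  have hc0 := ne_zero_of_mem_facetNormals hX1 hc
  have hn1 : ‖n‖ = 1 := norm_facetAxis hc0
  have ha1 := hX1 a (mem_tightSet.1 ha).1
  have hb1 := hX1 b (mem_tightSet.1 hb).1
  have hx1 := hX1 x (mem_tightSet.1 hx).1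
  have han : ⟪n, a⟫ = t := inner_facetAxis_of_tight (mem_tightSet.1 ha).2
  have hbn : ⟪n, b⟫ = t := inner_facetAxis_of_tight (mem_tightSet.1 hb).2
  have hxn : ⟪n, x⟫ = t := inner_facetAxis_of_tight (mem_tightSet.1 hx).2
  have hthalf : 1 / 2 < t := han ▸ half_lt_inner_facetAxis h12 hX1 hp hc ha
  have ht1 : t < 1 := han ▸ inner_facetAxis_lt_one hX1 hc ha
  -- the centred vectors
  set u := a - t • n with hu
  set v := b - t • n with hv
  set w := x - t • n with hw
  obtain ⟨huu, hnu⟩ := norm_sub_smul_sq_of_cap hn1 ha1 han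
  obtain ⟨hvv, hnv⟩ := norm_sub_smul_sq_of_cap hn1 hb1 hbn
  obtain ⟨hww, hnw⟩ := norm_sub_smul_sq_of_cap hn1 hx1 hxn
  have huv : ⟪u, v⟫ = 1 / 2 - t ^ 2 := by rw [hu, hv, inner_sub_smul_of_cap hn1 han hbn, hab]
  have huw : ⟪u, w⟫ = 1 / 2 - t ^ 2 := by rw [hu, hw, inner_sub_smul_of_cap hn1 han hxn, hax]
  have hvw : ⟪v, w⟫ = ⟪b, x⟫ - t ^ 2 := by rw [hv, hw, inner_sub_smul_of_cap hn1 hbn hxn]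
  -- three vectors orthogonal to `n ≠ 0` are linearly dependent
  have hdet : orient3 u v w = 0 := by
    by_contra hne
    have hli := linearIndependent_of_orient3_ne_zero hne
    have hn0 : n = 0 := by
      refine eq_zero_of_inner_linearIndependent_fin_three hli fun i => ?_
      fin_cases i
      · exact hnu
      · exact hnv
      · exact hnw
    rw [hn0, norm_zero] at hn1
    exact zero_ne_one hn1
  have hgram := orient3_sq_eq_gram u v w
  rw [hdet, real_inner_comm u w, huu, hvv, hww, huv, huw, hvw] at hgram
  -- `⟪b, x⟫ < 1`
  have hlt1 : ⟪b, x⟫ < 1 := inner_lt_one_of_ne_unit hb1 hx1 hbx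
  -- the Gram identity factors as `(1 − ⟪b,x⟫) · ((1 − t²)(1 − 2t² + ⟪b,x⟫) − 2(1/2 − t²)²)`
  have key : (1 - t ^ 2) * ⟪b, x⟫ = t ^ 2 - 1 / 2 := by
    have hfac : (1 - ⟪b, x⟫) * ((1 - t ^ 2) * ⟪b, x⟫ - (t ^ 2 - 1 / 2)) = 0 := by
      linear_combination -hgram
    rcases mul_eq_zero.1 hfac with h | h
    · exact absurd (by linarith : ⟪b, x⟫ = 1) hlt1.ne
    · linarith
  by_contra hq
  have hq' : ⟪b, x⟫ ≤ -1 / 3 := le_of_not_gt hq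
  have h1t : 0 < 1 - t ^ 2 := by
    have h := mul_pos (sub_pos.2 ht1) (show (0 : ℝ) < 1 + t by linarith)
    nlinarith [h]
  have ht2 : 1 / 4 < t ^ 2 := by nlinarith
  have hm := mul_le_mul_of_nonneg_left hq' h1t.le
  linarith [key, hm, ht2]

/-! ### Part B. Lemma 5 in facet form -/

/-- **Hales 2012, Lemma 5, facet form: `Σ_facets (4π · frac − (m − 2) sol₀) = 4π − 20 sol₀`**
for twelve unit vectors with `0` in the interior of their hull (`Σ frac = 1`, the cones over
the facets tile space; `Σ m_c = 24 + 2F − 4`, Legendre). [cite: Hales2012, Lemma 5] -/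
theorem sum_facet_weight_eq (h12 : X.card = 12) (hX1 : ∀ y ∈ X, ‖y‖ = 1)
    (h0 : (0 : E3) ∈ interior (convexHull ℝ (X : Set E3))) :
    ∑ c ∈ facetNormals X, (4 * π * ballFraction (0 : E3) (argmaxCone (facetNormals X) c) -
      ((tightSet X c).card - 2) * hales_sol0) = 4 * π - 20 * hales_sol0 := by
  have h1 : ∑ c ∈ facetNormals X, ballFraction (0 : E3) (argmaxCone (facetNormals X) c) = 1 :=
    sum_ballFraction_argmaxCone _ (facetNormals_nonempty h0)
  have h2 := sum_card_tightSet_eq hX1 h0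
  rw [h12] at h2
  rw [Finset.sum_sub_distrib, ← Finset.mul_sum, h1, ← Finset.sum_mul, Finset.sum_sub_distrib,
    h2]
  simp only [Finset.sum_const, nsmul_eq_mul]
  push_cast
  ring

end UnitDictionary

end Literature.Geometry.DiscreteGeometry

end
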